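import Summits.HodgeConjecture.HodgeConjecture.Theorems.MarkmanPartnerTransportPartnerExistenceLattice

/-!
# Route MarkmanPartnerTransport · support `PartnerExistence` (stmt-HodgeConjecture-19655) —
# the complexified transcendental space `T_ℚ ⊗ ℂ`, its period, and irreducibility

Sequel to `…PartnerExistenceLattice` (rational Néron–Severi space `N_ℚ`, `T_ℚ = N_ℚ^⊥`, `ℚ²³ = N_ℚ ⊕ T_ℚ`,
`dim T_ℚ = 23 − ρ(X)`), for a marked smooth projective fourfold `(X, φ, P, z)`:

* `mem_span_ratTransc_iff` — **`T_ℚ ⊗ ℂ = {y ∈ ℂ²³ : q(y, φ N¹(X)) = 0}`** (`= φ(T(X)_ℂ)`, the route's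
  `IsBBFTransc`): orthogonals of the non-degenerate form commute with `⊗_ℚ ℂ` (dimension count);
* `period_mem_span_ratTransc`, `star_period_mem_span_ratTransc` — the period `z` and `z̄` lie in
  `T_ℚ ⊗ ℂ` ((m5): `N¹(X)` consists of `(1,1)`-classes, which are `⊥ z, z̄`);
* `eq_zero_of_mem_ratTransc_of_orthogonal_period` — **a rational vector of `T_ℚ` orthogonal to the
  period is zero** (a rational `(1,1)`-class is algebraic by Lefschetz `(1,1)`, so it lies in
  `N_ℚ ∩ T_ℚ = 0`): the irreducibility input identifying `N¹(S)` of the prospective K3 partner with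
  `ι(T_ℚ)^⊥`.

No definition, no sorry, no named fact. Prover seat hodge-nonav-19652-p1 (gen 5), `--supports stmt-HodgeConjecture-19655`.

References: D. Huybrechts, *Lectures on K3 Surfaces*, Ch. 3 Def. 2.5 and Lemma 3.1; C. Voisin,
*Hodge Theory I*, §7.1.1 and Thm. 11.30.
-/

noncomputable section

set_option linter.dupNamespace false

open Module CategoryTheory
open Literature.AlgebraicTopology.SingularHomology Literature.Geometry.Kaehler
open Literature.AlgebraicGeometry Literature.AlgebraicGeometry.Motives Literature.AlgebraicGeometry.HodgeTheory
open Literature.AlgebraicGeometry.Hyperkaehler Literature.AlgebraicGeometry.Surfaces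
open Summit.HodgeConjecture.HodgeConjecture.Theorems.NikulinTwinTransport
open Summit.HodgeConjecture.HodgeConjecture.Theorems.MarkmanPartnerTransport.BBFPositivity

namespace Summit.HodgeConjecture.HodgeConjecture.Theorems.MarkmanPartnerTransport.PartnerLattice

variable {X : SchemeOver ℂ}

/-- `MarkedK3Sq[X, φ, P, z]`: VERBATIM the `let MarkedK3Sq := …` binder of the route declarations of
MarkmanPartnerTransport (clauses (m1)–(m6)). Local notation only. -/
local notation3 (prettyPrint := false) "MarkedK3Sq[" X ", " φ ", " P ", " z "]" =>
  (((IsIntegralClass P ∧ ∀ Q : complexBetti X (2 * 4), IsIntegralClass Q → ∃ n : ℤ, Q = n • P) ∧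
    (∀ c : complexBetti X 2, IsIntegralClass c ↔ ∃ v : K3HilbertIndex → ℤ, φ c = fun i => (v i : ℂ)) ∧
    (∀ a : complexBetti X 2, cupPowTwo a 4 = ((3 : ℂ) * (k3HilbertForm 2 (φ a) (φ a)) ^ 2) • P) ∧
    (IsOfHodgeType 4 X 2 2 0 (LinearEquiv.symm φ z) ∧
      ∀ τ : complexBetti X 2, IsOfHodgeType 4 X 2 2 0 τ → ∃ t : ℂ, τ = t • LinearEquiv.symm φ z) ∧
    (∀ c : complexBetti X 2, IsOfHodgeType 4 X 2 1 1 c ↔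
      (k3HilbertForm 2 (φ c) z = 0 ∧ k3HilbertForm 2 (φ c) (star z) = 0)) ∧
    (k3HilbertForm 2 z z = 0 ∧ 0 < (k3HilbertForm 2 (star z) z).re)))

/-- `qQ` = the rational Beauville–Bogomolov form of `K3^{[2]}`-type on `ℚ²³`. Local notation only. -/
local notation3 (prettyPrint := false) "qQ" => Matrix.toBilin' (Matrix.map (k3HilbertGram 2) (Int.cast : ℤ → ℚ))

/-- `qC` = the complex Beauville–Bogomolov form on `ℂ²³` as a Mathlib bilinear form. Local notation only. -/
local notation3 (prettyPrint := false) "qC" => Matrix.toBilin' (Matrix.map (k3HilbertGram 2) (Int.cast : ℤ → ℂ))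

section NS

variable {φ : complexBetti X 2 ≃ₗ[ℂ] (K3HilbertIndex → ℂ)} {P : complexBetti X (2 * 4)} {z : K3HilbertIndex → ℂ}
  {NQ : Submodule ℚ (K3HilbertIndex → ℚ)}

/-! ### `T_ℚ ⊗ ℂ` is the space of `q`-transcendental vectors -/

/-- **`T_ℚ ⊗ ℂ = {y ∈ ℂ²³ : q(y, φ N¹(X)) = 0}` (`= φ(T(X)_ℂ)`)**: orthogonals of the non-degenerate form
commute with `⊗_ℚ ℂ` (inclusion and the dimension count `23 − ρ` on both sides).
[cite: Huybrechts2016K3, Ch. 3 Def. 2.5 and Lemma 3.1] -/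
theorem mem_span_ratTransc_iff (hX : IsSmoothProjective 4 X)
    (hint : ∀ c : complexBetti X 2, IsIntegralClass c ↔ ∃ v : K3HilbertIndex → ℤ, φ c = fun i => (v i : ℂ))
    (hNQ : ∀ v, v ∈ NQ ↔ φ.symm (fun i => (v i : ℂ)) ∈ algebraicClasses X 1) (y : K3HilbertIndex → ℂ) :
    y ∈ Submodule.span ℂ ((fun a : K3HilbertIndex → ℚ => fun i => (a i : ℂ)) ''
        ((qQ).orthogonal NQ : Set (K3HilbertIndex → ℚ))) ↔
      ∀ d ∈ algebraicClasses X 1, k3HilbertForm 2 y (φ d) = 0 := by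
  set NC := Submodule.span ℂ ((fun a : K3HilbertIndex → ℚ => fun i => (a i : ℂ)) ''
    (NQ : Set (K3HilbertIndex → ℚ))) with hNC
  set TC := Submodule.span ℂ ((fun a : K3HilbertIndex → ℚ => fun i => (a i : ℂ)) ''
    ((qQ).orthogonal NQ : Set (K3HilbertIndex → ℚ))) with hTC
  -- `TC ≤ NC^⊥`
  have hle : TC ≤ (qC).orthogonal NC := by
    refine Submodule.span_le.2 ?_
    rintro _ ⟨t, ht, rfl⟩
    rw [SetLike.mem_coe, LinearMap.BilinForm.mem_orthogonal_iff]
    intro m hm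
    show qC m (fun i => (t i : ℂ)) = 0
    have hle' : NC ≤ LinearMap.ker (qC (fun i => (t i : ℂ))) := by
      refine Submodule.span_le.2 ?_
      rintro _ ⟨n, hn, rfl⟩
      rw [SetLike.mem_coe, LinearMap.mem_ker]
      beta_reduce
      rw [qC_apply, k3HilbertForm_ratCast, Rat.cast_eq_zero, qQ_comm]
      exact (LinearMap.BilinForm.mem_orthogonal_iff.1 ht) n hn
    have h2 := hle' hm
    rw [LinearMap.mem_ker, qC_apply] at h2
    rw [qC_apply, k3HilbertForm_comm]
    exact h2
  -- equal dimensions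
  have hfin : finrank ℂ ((qC).orthogonal NC) ≤ finrank ℂ TC := by
    rw [LinearMap.BilinForm.finrank_orthogonal qC_nondegenerate, hNC, finrank_span_ratCast, hTC,
      finrank_span_ratCast, LinearMap.BilinForm.finrank_orthogonal qQ_nondegenerate, finrank_rat23,
      finrank_complex23]
  have heq : TC = (qC).orthogonal NC := Submodule.eq_of_le_of_finrank_le hle hfin
  rw [heq, LinearMap.BilinForm.mem_orthogonal_iff, hNC, span_ratNeronSeveri hX hint hNQ]
  constructor
  · intro h d hd
    have h1 := h (φ d) (by rw [Submodule.mem_map_equiv, LinearEquiv.symm_apply_apply]; exact hd)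
    change qC (φ d) y = 0 at h1
    rwa [qC_apply, k3HilbertForm_comm] at h1
  · intro h m hm
    rw [Submodule.mem_map_equiv] at hm
    show qC m y = 0
    rw [qC_apply, k3HilbertForm_comm]
    have h1 := h _ hm
    rwa [LinearEquiv.apply_symm_apply] at h1

/-- **The period lies in `T_ℚ ⊗ ℂ`**: `z ⊥_q φ(N¹(X))`, as `N¹(X)` consists of `(1,1)`-classes and
`(1,1) ⟺ ⊥ z, z̄` (m5). [cite: Huybrechts2016K3, Ch. 3 Lemma 3.1] -/
theorem period_mem_span_ratTransc (hX : IsSmoothProjective 4 X) (hM : MarkedK3Sq[X, φ, P, z])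
    (hNQ : ∀ v, v ∈ NQ ↔ φ.symm (fun i => (v i : ℂ)) ∈ algebraicClasses X 1) :
    z ∈ Submodule.span ℂ ((fun a : K3HilbertIndex → ℚ => fun i => (a i : ℂ)) ''
        ((qQ).orthogonal NQ : Set (K3HilbertIndex → ℚ))) := by
  obtain ⟨-, hint, -, -, h11, -⟩ := id hM
  rw [mem_span_ratTransc_iff hX hint hNQ]
  intro d hd
  rw [k3HilbertForm_comm]
  exact ((h11 d).1 (isOfHodgeType_of_mem_algebraicClasses_of_isSmoothProjective hX 1 hd)).1

/-- **The conjugate period lies in `T_ℚ ⊗ ℂ`** (second clause of (m5)). [cite: Huybrechts2016K3, Ch. 3 Lemma 3.1] -/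
theorem star_period_mem_span_ratTransc (hX : IsSmoothProjective 4 X) (hM : MarkedK3Sq[X, φ, P, z])
    (hNQ : ∀ v, v ∈ NQ ↔ φ.symm (fun i => (v i : ℂ)) ∈ algebraicClasses X 1) :
    star z ∈ Submodule.span ℂ ((fun a : K3HilbertIndex → ℚ => fun i => (a i : ℂ)) ''
        ((qQ).orthogonal NQ : Set (K3HilbertIndex → ℚ))) := by
  obtain ⟨-, hint, -, -, h11, -⟩ := id hM
  rw [mem_span_ratTransc_iff hX hint hNQ]
  intro d hd
  rw [k3HilbertForm_comm]
  exact ((h11 d).1 (isOfHodgeType_of_mem_algebraicClasses_of_isSmoothProjective hX 1 hd)).2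

/-! ### Irreducibility: a rational transcendental vector orthogonal to the period vanishes -/

/-- **A rational vector of `T_ℚ` orthogonal to the period is zero.** `φ⁻¹ t` is a rational, hence real,
class with `q(t, z) = 0` and so `q(t, z̄) = 0`: a `(1,1)`-class (m5), algebraic by Lefschetz `(1,1)`
(`lefschetzOneOne_rational_holds`), i.e. `t ∈ N_ℚ ∩ T_ℚ = 0`.  This is the irreducibility of the
transcendental Hodge structure used to identify `N¹(S)` of the K3 partner. [cite: Huybrechts2016K3, Ch. 3 Lemma 3.1]
[cite: VoisinHodgeI2002, Thm. 11.30] -/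
theorem eq_zero_of_mem_ratTransc_of_orthogonal_period (hX : IsSmoothProjective 4 X)
    (hM : MarkedK3Sq[X, φ, P, z])
    (hNQ : ∀ v, v ∈ NQ ↔ φ.symm (fun i => (v i : ℂ)) ∈ algebraicClasses X 1)
    {t : K3HilbertIndex → ℚ} (ht : t ∈ (qQ).orthogonal NQ)
    (htz : k3HilbertForm 2 (fun i => (t i : ℂ)) z = 0) : t = 0 := by
  obtain ⟨-, hint, -, -, h11, -⟩ := id hM
  set c : complexBetti X 2 := φ.symm (fun i => (t i : ℂ)) with hcdef
  have hφc : φ c = fun i => (t i : ℂ) := φ.apply_symm_apply _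
  have hrat : IsRationalClass c := (isRationalClass_iff_of_markedSq hX hint c).2 ⟨t, hφc⟩
  have hreal : star (φ c) = φ c := by
    rw [hφc]
    funext i
    simp only [Pi.star_apply, Complex.star_def, Complex.conj_ofReal, ← Complex.ofReal_ratCast]
  have htz' : k3HilbertForm 2 (φ c) (star z) = 0 := by
    have h := congrArg star htz
    rw [star_k3HilbertForm, star_zero, ← hφc, hreal] at h
    exact h
  have hc11 : IsOfHodgeType 4 X 2 1 1 c := (h11 c).2 ⟨by rw [hφc]; exact htz, htz'⟩
  have hcN : c ∈ algebraicClasses X 1 := lefschetzOneOne_rational_holds hX c hrat hc11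
  have htN : t ∈ NQ := (hNQ t).2 hcN
  have h0 : t ∈ NQ ⊓ (qQ).orthogonal NQ := Submodule.mem_inf.2 ⟨htN, ht⟩
  rw [ratNeronSeveri_inf_orthogonal_eq_bot hX hM hNQ, Submodule.mem_bot] at h0
  exact h0

end NS

end Summit.HodgeConjecture.HodgeConjecture.Theorems.MarkmanPartnerTransport.PartnerLattice

end
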